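import Literature.Claims.NS.ClayVariants
import Literature.Analysis.FluidPDE.NSVorticityBKM
import Literature.Analysis.FluidPDE.NSVorticityBKMEnergy
import Literature.Analysis.FluidPDE.ClassicalSobolevUniqueness
import Literature.Analysis.FluidPDE.CheskidovShvydkoyRegularProofs
import Literature.Analysis.FluidPDE.TaoLocalisationContinuation
import Literature.Analysis.FluidPDE.ClassicalNSHorizonPatching
import HarnessLib

/-!
# Claim skeleton (D-0090 NS-CLAIMS, C13): J. Kampen, «On an auto-controlled global existence scheme of
# the incompressible Navier Stokes equation», arXiv:1309.4824 v11 (2014)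

Cell `ns-claims`, claim C13, typist `ns-claims-typist-12` (lanes: refuter-7, ref-3, salvage-p4,
writer-1). UNREFEREED CLAIM under adjudication — NOTHING in this file asserts a step: every `Step_k`
is a `Prop`; the only `theorem`s are kernel compositions of the paper's own implications, the Clay
link, and small unfolding lemmas. Text of record (PINNED by ns-claims-lit-1, `pub/ns-claims/sources/
Kampen2014/LOCATORS.md` §0): arXiv:1309.4824 **v11** (22 May 2014, math.AP, 75 pp.), bib
`Kampen2014AutoControlledNS`; print page = PDF page; `(n)` = printed display number, TeX labels of
`arXiv1309.4824v11.tex` in brackets. The typed proof path is the SELF-CONTAINED APPENDIX (§5 «Statement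
of the linear upper bound theorem», §6 «Proof of the theorem», pp. 58–75: Thm 5.1 ⇐ Lemma 6.1, Lemma 6.4,
Lemma 6.15 and the contradiction argument pp. 62–65) — the path the pin designates; the long scheme of
§4 (pp. 19–52, Thm 4.3) is the same mechanism with a global clock (ref-3 RETYPE 0b(iii)) and is not typed.
Cluster context (not typed): 1004.4589 v6 (external control function, superseded), 1412.8438 v10
(conditional bounds + Euler/forced claims), 1401.2734, 1212.2403 (LOCATORS §0, CARD §1).

## Claimed statement (as printed)

Thm 5.1, p. 58–59 [mthm] (= Thm 1.2 p. 6 [mainthm] with an explicit bound): «We are interested in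
n ≥ 3. We assume ν > 0 and that for all 1 ≤ i ≤ n we have h_i ∈ H^m ∩ C^m for m ≥ 2 … Then we claim
that there is a global regular solution v_i, 1 ≤ i ≤ n of (275) with v_i ∈ C¹((0,∞), H^m ∩ C^m) ∩
C⁰([0,∞), H^m ∩ C^m), (276) and such that there exists a constant C > 0 with ‖v_i(t,·)‖_{H^m} ≤ C + Ct
(277) for all t ≥ 0.» Here (275) (p. 58; = (1) p. 2) is the Navier–Stokes system on `[0,∞) × ℝⁿ` in
Leray-projection form (pressure eliminated by the Newtonian potential `K_n`), constant viscosity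
`ν > 0`, no force. Remark 5.2 p. 59: the weak reading (278) «∀T ∃C ∀t ≤ T» vs the strong reading (279)
«∃C ∀T»: «Both claims can be proved». §6 first sentence p. 59: «uniqueness is not claimed by this
method» (Remark 1.4 p. 7 takes it from Gronwall in the class). Cor 1.5 p. 7 [maincor]: pointwise decay
`lim_{t→∞}|v_i(t,x)| = 0` (`ClaimedDecay`, typed apart).

RENDERING (tree conventions, as in the cell's other skeletons): `n = 3`; data `h ∈ H^m ∩ C^m, m ≥ 2`
are rendered on the `H^∞ ∩ C^∞` sub-class (`IsDatum`: smooth, divergence free, every derivative in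
`L²`) — it contains every Clay datum (4), and divergence-freeness (implicit in the Leray form (275))
is made explicit; «regular solution v ∈ C¹((0,∞),H^m∩C^m) ∩ C⁰([0,∞),H^m∩C^m) of (275)» = a classical
solution `(v, p)` of the unprojected system in the Beale–Kato–Majda class (`IsClassicalNSSolutionOn`,
all `L²` Sobolev norms bounded on compact time intervals: `IsLocalSolution`, `IsGlobalSolution`); the
norm `‖·‖_{H^m ∩ C^m}` (never displayed in print) = `‖·‖_{H^m} + ‖·‖_{C^m}` (`hcNorm m`), `‖·‖_{H^m}`
= `hmNorm m` with Fréchet-derivative tensors. TODO(general form): `n ≥ 3`, variable viscosity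
`0 < λ₀ ≤ ν ∈ C^m_b`, finite `m`, data merely `H^m ∩ C^m`. None of the typed Steps depends on the
rendering beyond bookkeeping.

## Clay delta (reference `Literature.Claims.NS.ClayVariants`, axes Δ1–Δ8)

Nearest: (A). Δ1 domain `ℝⁿ`, `n ≥ 3` ⊇ `ℝ³` = · Δ2 equations: Leray-projection form (equivalent for
classical decaying solutions; rendered by the unprojected system) · Δ3 force ≡ 0 = · Δ4 data `H^m ∩ C^m`
⊋ (4): STRONGER · Δ5 classical + `H^m` bounds on compacts; the energy bound (7) is NOT printed (Cor 1.5
gives pointwise decay) but HOLDS in the rendered class by the tree's energy inequality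
`IsClassicalNSSolutionOn.bkm_energy_le` — so `clay_of_claimed : ClaimedTheorem →
ClayVariants.clayR3.Regularity` is PROVED below (no delta of substance) · Δ7 every `ν > 0` =. «Wrong
problem» is not available as a verdict for this claim.

## The paper's objects (§6, pp. 59–62, 72)

* (281) p. 59: the local dilated clock `t − t₀ = ρ(τ − t₀)`, `v^{ρ,t₀}(τ,·) = v(t,·)`, `τ ∈ [t₀, t₀+1]`.
* (283)–(284) p. 60: the comparison function `(1 + τ) u^{ρ,t₀}(σ,·) = v^{ρ,t₀}(τ,·)`,
  `σ = (τ − t₀)/√(1 − (τ − t₀)²) ∈ [0, ∞)`; inverse `τ(σ) = t₀ + σ/√(1 + σ²)` (`tauOf`); hence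
  `u^{ρ,t₀}(σ,x) = (1 + τ(σ))⁻¹ v(t₀ + ρ(τ(σ) − t₀), x)` (`uComp`).
* (291)–(292) p. 61: `u^{ρ,t₀}` solves `∂_σ u − ρμ^{τ,1}νΔu + ρμ^{τ,2}(u·∇)u + μu = ρμ^{τ,2}·Leray(u)` with
  `μ(σ) = (1 − τ_{t₀}(σ)²)^{3/2}/(1 + τ(σ)) = (1 + σ²)^{−3/2}/(1 + τ(σ))` (`muOf`), `μ^{τ,k} = (1+τ)^k μ` —
  «a strong damping term μu (without a possibly small ρ), while all spatial derivative terms in (291)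
  have this factor ρ» (p. 61). A chain-rule computation, re-derived by ref-3; not a Step.
* (357)/(358) p. 72: on `σ ∈ [0, 1/√3]` (i.e. `τ ∈ [t₀, t₀ + 1/2]`, `c_e = 1/2`):
  `inf μ ≥ 3√3/(12 + 8t₀) =: c_{μ,t₀}` (`cmuLow`), `sup μ(1+τ)² ≤ 3/2 + t₀ =: c^μ_{t₀}` (`cmuUp`).

## Steps (paper item · print page · typist's private flag) — ORDERED INDEX (TYPING-HYGIENE 11),
## dependency order of the appendix chain (ties by print order)

Step 1 = `Step_1` (Lemma 6.1 p. 59: local existence in `H^m ∩ C^m` from data at any time `t₀`,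
with «a small time horizon ρ» depending on the data bound — classical, cite) · Step 2 = `Step_2`
((357)–(358) p. 72: the coefficient bounds for `μ` of (292) — a calculus fact, true per ref-3) ·
Step 3 = `Step_3` ((359) p. 72 [l.3648–3656]: the DAMPING GAIN over one sub-step of length
`Δ = σ_p − σ_{p−1}`: «−|∫_{(p−1)Δ}^{pΔ}∫ μ(s) u^{ρ′,t₀,p,q−1}_{i,α}(s,y) G_p(pΔ,·;s,y) dy ds|_{H^m∩C^m} ≤
−c_{μ,t₀}(σ_p − σ_{p−1})^α |u^{ρ′,t₀,p,q−1}_{i,α}(σ_{p−1},·)|_{H^m∩C^m} for α ∈ (0,1) (you may expect that the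
latter statement holds up to an ε > 0 but as μ(s) > c_{μ,t₀} it holds indeed as stated)», typed AT THE
GRAIN OF THE FIRST ITERATE `q = 1` (time-independent by definition, p. 71 l.3590) over an abstract
norm-along-time with the two printed properties `∫G_p dy = 1` and `μ ≤ μ(0) = 1/(1+t₀)` — HYGIENE 13,
the shape of ns-claims-ref-3's `not_damping_gain_of_lipschitz_step`; scalar core `Step_3Scalar`) —
suspicious (a gain of order `Δ^α`, `α < 1`, from an increment of order `Δ`) · Step 4 = `Step_4`
(Lemma 6.15 p. 70, (350) [lem3, (preserv)]: discrete bound preservation for the comparison function on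
the grid `σ_p = pΔ ≤ 1/√3` with a triple `(Δ, c, ρ)` independent of `p` (Remark 6.16); printed proof
pp. 71–75 = (356) + Step 3 + (362)–(367) + the closing display (369)
`ρ ≤ [c_{μ,t₀}Δ^{α+δ−1}C/2 − ε]/[c^μ_{t₀} n C_G C_m(1 + nC_K) C²]`) — suspicious (rests on Step 3) · Step 5 =
`Step_5` (Lemma 6.4 p. 62, (295) [lem2]: «there is some 0 < ρ ≤ ρ̃ (which does not depend essentially
on the time horizon T > 0)» — Remark 6.6: «ρ ≳ 1/T^s for some s ∈ (0,1)»; p. 64: «(315) holds for a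
ρ > 0 which depends only on C, n, ν and T» — «such that ‖u^{ρ,t₀}(0)‖_{H^m∩C^m} ≤ C ⇒ ‖u^{ρ,t₀}(σ)‖ ≤ C for
all σ ≥ 0»; ⇐ Lemma 6.15 by Remark 6.5) — the LOAD-BEARING a priori statement · Step 6 = `Step_6`
(pp. 62–63, (299)–(308): transfer back to `v` on `[t_max, t_max + ρc_e]` with the SAME constant —
«All these variations imply that there exists some C > 0 such that ‖v^{t_max}(t,·)‖_{H^m∩C^m} ≤ (1+t)C
(308) … Then (296) together with (308) lead to a contradiction to the maximality of t_max in (296)»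
(the contradiction needs the `C` of (296)); abstract grain `Step_6Abs`; the paper's own weaker variant
Remark 6.7 (316) with `C′ = C/ρ` = `Step_6Weak` (true arithmetic, «Hence there is no simple transition to
(308) with the same C > 0», p. 64)) — suspicious · Step 7 = `Step_7` (pp. 62–65: the conclusion of the
contradiction argument in the weak reading (278)/(309) — for every `T` a classical solution on `[0,T]`
in the class with `‖v(t)‖_{H^m} ≤ C + Ct`) and `Step_7s` (the strong reading (279) = (277), p. 59 «Both
claims can be proved», p. 65 «Hence the statement in (277) of the main theorem holds with the constant
C′») — load-bearing for the headline · Step 8 = `Step_8` (IMPLICIT, pp. 58–59 (276): from solutions on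
every `[0,T]` to ONE global regular solution carrying the bounds — uniqueness in the class (Remark 1.4
p. 7) + gluing; classical, unprinted).

## COMPOSITION — proved as `claim_of_steps`

`claim_of_steps : Step_1 → Step_2 → Step_3 → Step_4 → Step_5 → Step_6 → Step_7 → Step_7s → Step_8 →
ClaimedTheorem` — PROVED; it consumes `Step_7s` and `Step_8` (Thm 5.1 (276)–(277) follows from the
STATEMENT reached at the end of the contradiction argument plus the implicit globalisation). Steps 1–6
are the printed support of Step 7/7s, in dependency order: Lemma 6.1 (restart at `t_max`, p. 62),
Lemma 6.4 ⇐ Lemma 6.15 ⇐ (359); then the transfer (308). NOT derivable as typed and NOT bridged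
(BREAKS-AT-LOGIC candidates if the Steps survive): `Step_5 ∧ Step_6Weak → Step_7` — with the honest
constant `C′ = C/ρ` of (316) the next restart needs Lemma 6.4 with `C` replaced by `C/ρ`, whose `ρ`
«depends only on C, n, ν and T» (p. 64) and therefore changes; the print asserts «ρ … independent of
t_max» (p. 65) but needs independence of `C` — the induction over restarts is not carried out (ref-3
RETYPE 0b(iv): loss factor `(2+t₀)/(1+t₀+ρ)` per step). `clay_of_claimed` PROVED (energy inequality in
the class). `ClaimedDecay` (Cor 1.5) is not composed (its §4/§6 argument is downstream of Step 5).

Design notes. Physical space `EuclideanSpace ℝ (Fin 3)` spelled out; no notation, no instance. `⨆` in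
`cmNorm` and `.toReal` in `hmNorm` are junk-free on the rendered class (smooth slices with all Sobolev
norms bounded ⇒ bounded derivatives, `exists_forall_norm_iteratedFDeriv_le_bkmClass`); TYPING-HYGIENE §1
noted. Quantifier order of Lemma 6.4 typed as on p. 64: `ρ = ρ(ν, m, C, T)` chosen BEFORE `t₀ ∈ [0,T]`
and before the solution (F2/F11). The half-step `c_e = 1/2` (p. 72 «For notational convenience we set
c_e = 1/2») is used in Steps 4 and 6.

Rev 2 (additive; ns-claims-ref-3 TYPING NOTE 20:19:28Z (ii)–(iv), lead RULING 20:22:24Z (2)). ORDERED INDEX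
inserts: Step 3½ = `Step_4Close` ((366)–(369) pp. 74–75: the closing display of Lemma 6.15's proof — the
inference by which the ρ-choice CONSUMES the damping gain (359) = Step 3; abstract grain, `ε`-free form,
PROVED `step_4Close_holds`; the literal `ε`-bookkeeping recorded by `step_4Close_residual`) between Step 3
and Step 4; Step 5′ = `Step_5Unif` (Lemma 6.4 (295) WITH Remark 6.6's clause «ρ ≳ 1/T^s, s ∈ (0,1)») in
Step 5's position (`step_5_of_step_5Unif` PROVED). Clock (ref-3 F2): every Step over `uComp` (Steps 4, 5,
5Unif, 6) runs on the LOCAL dilated clock (281) p. 59 / p. 61 «t − t₀ = ρ(τ − t₀)» restarted at each `t₀`;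
the global clock `t = ρτ` of (2) p. 1 and §4 appears nowhere in this file. Coefficient (ref-3 F1):
`μ^{τ,2} = (1+τ)²μ` of (292) keeps its factor `(1+τ)²` — it is the `(1 + tauOf t₀ σ)^2` of `Step_2` ((358))
and the factor `cmuUp t₀` of the loss constant in `Step_4Close` ((365)–(366): every nonlinear increment
carries `ρc^μ_{t₀}`); the bounded-coefficient variant is the «variation of a scheme» (p. 61, §4), not
Lemma 6.4 as printed, and is not typed. Lineage (not used here): arXiv 1502.06699 v3 (2016) restates this
conclusion in its Cor 1.8 / Appendix 1 CONDITIONAL on «local time contraction results … proved elsewhere»;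
its Thms 1.2 / 1.7 (Leray–Hopf solutions on 𝕋ⁿ, CKN) are a different claim, sub-row C13b `Kampen2015`
(`pub/ns-claims/sources/Kampen2014/LOCATORS.md` §0b).

WHAT THIS IS NOT: not a claim about NS regularity or blow-up; not a claim about any author beyond the
typed locator.
-/

noncomputable section

open Set Function Filter MeasureTheory
open scoped Topology ENNReal NNReal ContDiff

namespace Literature.Claims.NS.Kampen2014

open Literature.Analysis.FluidPDE

/-! ### Vocabulary (definitions with bodies; nothing asserted) -/

/-- `‖w‖²_{H^m} = Σ_{|α| ≤ m} ∫|D^α w|²` (p. 2 «H^s is the Sobolev space of order s»; (277)), rendered with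
the Fréchet-derivative tensors `Dⁿw`, `n ≤ m` (equivalent up to combinatorial constants), in `ℝ≥0∞`.
[cite: Kampen2014AutoControlledNS, §1 p. 2, (277) p. 59] -/
def hmNormSq (m : ℕ) (w : EuclideanSpace ℝ (Fin 3) → EuclideanSpace ℝ (Fin 3)) : ℝ≥0∞ :=
  ∑ n ∈ Finset.range (m + 1), ∫⁻ x, ‖iteratedFDeriv ℝ n w x‖ₑ ^ 2

/-- `‖w‖_{H^m}` as a real number (finite on the rendered class). [cite: Kampen2014AutoControlledNS, (277) p. 59] -/
def hmNorm (m : ℕ) (w : EuclideanSpace ℝ (Fin 3) → EuclideanSpace ℝ (Fin 3)) : ℝ :=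
  Real.sqrt (hmNormSq m w).toReal

/-- `‖w‖_{C^m} = Σ_{n ≤ m} sup_x ‖Dⁿw(x)‖` (p. 2 «C^m … continuous multivariate derivatives up to order m»;
the paper uses the Banach norm of `H^m ∩ C^m` without displaying it). [cite: Kampen2014AutoControlledNS, §1 p. 2] -/
def cmNorm (m : ℕ) (w : EuclideanSpace ℝ (Fin 3) → EuclideanSpace ℝ (Fin 3)) : ℝ :=
  ∑ n ∈ Finset.range (m + 1), ⨆ x, ‖iteratedFDeriv ℝ n w x‖

/-- `‖w‖_{H^m ∩ C^m} := ‖w‖_{H^m} + ‖w‖_{C^m}` — the norm of (293)–(295), (348)–(350) (the standard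
intersection norm; not displayed in print). [cite: Kampen2014AutoControlledNS, (293)–(295) pp. 61–62] -/
def hcNorm (m : ℕ) (w : EuclideanSpace ℝ (Fin 3) → EuclideanSpace ℝ (Fin 3)) : ℝ :=
  hmNorm m w + cmNorm m w

/-- The DATA CLASS «h_i ∈ H^m ∩ C^m for m ≥ 2» (Thm 5.1 p. 58), RENDERED on the tree's `H^∞ ∩ C^∞` class
(smooth, every derivative in `L²`) with the divergence condition of the Leray form made explicit; contains
every Clay datum (4). TODO(general form): finite `m`. [cite: Kampen2014AutoControlledNS, Thm 5.1 p. 58] -/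
def IsDatum (h : EuclideanSpace ℝ (Fin 3) → EuclideanSpace ℝ (Fin 3)) : Prop :=
  ContDiff ℝ ∞ h ∧ VectorCalculus.IsDivFree h ∧ ∀ n : ℕ, ∫⁻ x, ‖iteratedFDeriv ℝ n h x‖ₑ ^ 2 < ⊤

/-- A regular solution of (275) on the closed time slab `[a, b]` (Lemma 6.1's class
«C¹((0,ρ], H^m∩C^m) ∩ C⁰([0,ρ], H^m∩C^m)», restarted at `t₀`, p. 59), RENDERED in the BKM class of the
tree: classical unforced solution `(u, p)` on `ℝ³ × [a, b]` with all `L²` Sobolev norms of `u` bounded on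
`[a, b]`. [cite: Kampen2014AutoControlledNS, Lemma 6.1 and (281) p. 59] -/
def IsLocalSolution (ν a b : ℝ) (u : ℝ → EuclideanSpace ℝ (Fin 3) → EuclideanSpace ℝ (Fin 3))
    (p : ℝ → EuclideanSpace ℝ (Fin 3) → ℝ) : Prop :=
  IsClassicalNSSolutionOn (Icc a b) ν 0 u p ∧ HasBoundedSobolevNormsOn (Icc a b) u

/-- «a global regular solution v_i of (275) with v_i ∈ C¹((0,∞), H^m ∩ C^m) ∩ C⁰([0,∞), H^m ∩ C^m)» (276)
p. 58, from the datum `h`, RENDERED in the BKM class: classical unforced solution on `ℝ³ × [0,∞)` with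
`u(0) = h` and all `L²` Sobolev norms bounded on every `[0,T]`. [cite: Kampen2014AutoControlledNS, Thm 5.1 (276) p. 58] -/
structure IsGlobalSolution (ν : ℝ) (h : EuclideanSpace ℝ (Fin 3) → EuclideanSpace ℝ (Fin 3))
    (u : ℝ → EuclideanSpace ℝ (Fin 3) → EuclideanSpace ℝ (Fin 3)) (p : ℝ → EuclideanSpace ℝ (Fin 3) → ℝ) :
    Prop where
  /-- (275) holds classically on `ℝ³ × [0,∞)`. -/
  isClassical : IsClassicalNSSolutionOn (Ici 0) ν 0 u p
  /-- `v(0,·) = h`. -/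
  initial : u 0 = h
  /-- (276) rendered: all Sobolev norms bounded on every `[0,T]`. -/
  sobolev : ∀ T : ℝ, HasBoundedSobolevNormsOn (Icc 0 T) u

/-- The inverse of the dilation (284) p. 60: `σ = (τ − t₀)/√(1 − (τ − t₀)²)` ⇔ `τ(σ) = t₀ + σ/√(1 + σ²)`
(«We denote the inverse of the time dilatation by τ ≡ τ(σ) (easily computed explicitly)», p. 61).
[cite: Kampen2014AutoControlledNS, (284) p. 60, p. 61] -/
def tauOf (t₀ σ : ℝ) : ℝ :=
  t₀ + σ / Real.sqrt (1 + σ ^ 2)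

/-- The comparison function (281)+(283)+(284) pp. 59–60: `u^{ρ,t₀}(σ, x) = v^{ρ,t₀}(τ(σ), x)/(1 + τ(σ))
= v(t₀ + ρ(τ(σ) − t₀), x)/(1 + τ(σ))`, for the original velocity `v`.
[cite: Kampen2014AutoControlledNS, (281) p. 59, (283)–(284) p. 60] -/
def uComp (ρ t₀ : ℝ) (v : ℝ → EuclideanSpace ℝ (Fin 3) → EuclideanSpace ℝ (Fin 3)) (σ : ℝ)
    (x : EuclideanSpace ℝ (Fin 3)) : EuclideanSpace ℝ (Fin 3) :=
  (1 + tauOf t₀ σ)⁻¹ • v (t₀ + ρ * (tauOf t₀ σ - t₀)) x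

/-- The damping coefficient (292) p. 61: `μ(σ) = (1 − τ_{t₀}(σ)²)^{3/2}/(1 + τ(σ))`; with
`τ_{t₀} = σ/√(1+σ²)` one has `1 − τ_{t₀}² = 1/(1+σ²)`, so `μ(σ) = (1 + σ²)^{−3/2}/(1 + τ(σ))`.
[cite: Kampen2014AutoControlledNS, (292) p. 61] -/
def muOf (t₀ σ : ℝ) : ℝ :=
  (1 + σ ^ 2) ^ (-(3:ℝ) / 2) / (1 + tauOf t₀ σ)

/-- `c_{μ,t₀} := 3√3/(12 + 8t₀)`, the printed lower bound (357) p. 72 of `μ` on `σ ∈ [0, 1/√3]`.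
[cite: Kampen2014AutoControlledNS, (357) p. 72] -/
def cmuLow (t₀ : ℝ) : ℝ :=
  3 * Real.sqrt 3 / (12 + 8 * t₀)

/-- `c^μ_{t₀} := 3/2 + t₀`, the printed upper bound (358) p. 72 of `μ(1+τ)²` on `σ ∈ [0, 1/√3]`.
[cite: Kampen2014AutoControlledNS, (358) p. 72] -/
def cmuUp (t₀ : ℝ) : ℝ :=
  3 / 2 + t₀

/-! ### The claimed statements -/

/-- **The claimed theorem, as printed (Thm 5.1 pp. 58–59 = Thm 1.2 p. 6 with (277))**, rendered for
`n = 3`: for every `ν > 0` and every datum of the class there is a global regular solution (276) from it,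
and for every `m ≥ 2` a constant `C` with `‖v(t,·)‖_{H^m} ≤ C + Ct` for all `t ≥ 0` (277) (the strong
reading (279); Remark 5.2 p. 59: «Both claims can be proved»).
[cite: Kampen2014AutoControlledNS, Thm 5.1 (276)–(277) pp. 58–59, Thm 1.2 p. 6] -/
def ClaimedTheorem : Prop :=
  ∀ ν : ℝ, 0 < ν → ∀ h : EuclideanSpace ℝ (Fin 3) → EuclideanSpace ℝ (Fin 3), IsDatum h →
    ∃ (u : ℝ → EuclideanSpace ℝ (Fin 3) → EuclideanSpace ℝ (Fin 3))
      (p : ℝ → EuclideanSpace ℝ (Fin 3) → ℝ),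
      IsGlobalSolution ν h u p ∧
        ∀ m : ℕ, 2 ≤ m → ∃ C : ℝ, ∀ t : ℝ, 0 ≤ t → hmNorm m (u t) ≤ C + C * t

/-- **Corollary 1.5 p. 7 [maincor]** (and abstract: «for the incompressible Navier Stokes equation there is
a decay to zero at infinite time»): the global regular solution satisfies `lim_{t→∞} |v_i(t,x)| = 0`
pointwise. Typed apart (not composed; its argument is downstream of Lemma 6.4).
[cite: Kampen2014AutoControlledNS, Cor 1.5 p. 7] -/
def ClaimedDecay : Prop :=
  ∀ ν : ℝ, 0 < ν → ∀ h : EuclideanSpace ℝ (Fin 3) → EuclideanSpace ℝ (Fin 3), IsDatum h →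
    ∃ (u : ℝ → EuclideanSpace ℝ (Fin 3) → EuclideanSpace ℝ (Fin 3))
      (p : ℝ → EuclideanSpace ℝ (Fin 3) → ℝ),
      IsGlobalSolution ν h u p ∧
        ∀ x : EuclideanSpace ℝ (Fin 3), Tendsto (fun t => u t x) atTop (𝓝 0)

/-! ### The steps -/

/-- **Step 1 — Lemma 6.1 p. 59 (existence of local solutions)**: «For data h_i ∈ H^m ∩ C^m … m ≥ 2 there
exists a small time horizon ρ > 0 such that there is a local solution v_i : [0,ρ] × ℝⁿ → ℝ … of (275) …
(280). The lemma can be proved by a local contraction argument. It is clear that the lemma 6.1 may be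
applied to the equation in (275) with data v_i(t₀,·) ∈ H^m ∩ C^m if we have such data at time t₀ ≥ 0.»
RENDERED (with the uniformity the contradiction argument p. 62 and Lemmas 6.4/6.15 use: «ρ̃ such that
Lemma 6.1 holds»): for `ν > 0`, `m ≥ 2` and a bound `B` there is `ρ̃ > 0` such that every datum of the
class with `‖w‖_{H^m∩C^m} ≤ B`, posed at any time `t₀ ≥ 0`, launches a regular solution on `[t₀, t₀ + ρ̃]`.
Typist's flag: classical (Kato 1972 / Majda–Bertozzi Thm 3.4; tree `MajdaBertozzi2002_localExistenceH3`
shape, translated in time). [cite: Kampen2014AutoControlledNS, Lemma 6.1 (280) p. 59] -/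
def Step_1 : Prop :=
  ∀ ν : ℝ, 0 < ν → ∀ m : ℕ, 2 ≤ m → ∀ B : ℝ, 0 < B → ∃ ρt : ℝ, 0 < ρt ∧
    ∀ t₀ : ℝ, 0 ≤ t₀ → ∀ w : EuclideanSpace ℝ (Fin 3) → EuclideanSpace ℝ (Fin 3), IsDatum w →
      hcNorm m w ≤ B →
        ∃ (u : ℝ → EuclideanSpace ℝ (Fin 3) → EuclideanSpace ℝ (Fin 3))
          (p : ℝ → EuclideanSpace ℝ (Fin 3) → ℝ), IsLocalSolution ν t₀ (t₀ + ρt) u p ∧ u t₀ = w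

/-- **Step 2 — (357)–(358) p. 72, the coefficient bounds for `μ` of (292) on the half-step `c_e = 1/2`**:
«inf_{σ ∈ [0,1/√3]} μ(σ) = inf_{τ ∈ [t₀, t₀+1/2]} (1 − τ_{t₀}(σ)²)^{3/2}/(1 + τ(σ)) ≥ 3√3/(12 + 8t₀) = c_{μ,t₀}
(357) and … sup_{σ ∈ [0,1/√3]} μ(σ)(1 + τ(σ))² ≤ (3/2 + t₀) =: c^μ_{t₀} (358)». Typist's flag: calculus
(re-derived by ref-3: correct). [cite: Kampen2014AutoControlledNS, (357)–(358) p. 72] -/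
def Step_2 : Prop :=
  ∀ t₀ : ℝ, 0 ≤ t₀ → ∀ σ : ℝ, 0 ≤ σ → σ ≤ 1 / Real.sqrt 3 →
    cmuLow t₀ ≤ muOf t₀ σ ∧ muOf t₀ σ * (1 + tauOf t₀ σ) ^ 2 ≤ cmuUp t₀

/-- **Step 3 — (359) p. 72 [l.3648–3656], the DAMPING GAIN, at the grain of the first iterate `q = 1`
(TYPING-HYGIENE 13).** Printed: «as μ(s) > c_{μ,t₀} for s ∈ [(p−1)Δ, pΔ) there exists a 0 < ρ′ ≤ ρ̃ such
that −|∫_{(p−1)Δ}^{pΔ}∫_{ℝⁿ} μ(s) u^{ρ′,t₀,p,q−1}_{i,α}(s,y) G_p(pΔ,·;s,y) dy ds|_{H^m∩C^m} ≤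
−c_{μ,t₀}(σ_p − σ_{p−1})^α |u^{ρ′,t₀,p,q−1}_{i,α}(σ_{p−1},·)|_{H^m∩C^m} (359) for α ∈ (0,1) (you may expect
that the latter statement holds up to an ε > 0 but as μ(s) > c_{μ,t₀} it holds indeed as stated)»; used at
(360)/(366) as the amount by which the norm DROPS over the sub-step. For `q = 1` the iterate is
time-independent (p. 71: «u^{ρ,t₀,p,0} … by definition»), `∫G_p dy = 1` and `μ ≤ μ(0) = 1/(1+t₀)`, so the
damping evolution loses at most `(1+t₀)⁻¹·Δ` times the norm over a sub-step of length `Δ`. TYPED over an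
abstract norm-along-time `N` carrying exactly that one-step loss bound: the printed gain
`N(σ₀ + Δ) ≤ N(σ₀) − c_{μ,t₀} Δ^α N(σ₀)` for all small `Δ`. (Shape = ns-claims-ref-3's
`not_damping_gain_of_lipschitz_step` with `M = (1+t₀)⁻¹`, `c = c_{μ,t₀}`.) Typist's flag: suspicious
(`Δ` vs `Δ^α`). [cite: Kampen2014AutoControlledNS, (359) p. 72] -/
def Step_3 : Prop :=
  ∀ t₀ : ℝ, 0 ≤ t₀ → ∀ α : ℝ, 0 < α → α < 1 → ∀ Δ₁ : ℝ, 0 < Δ₁ → Δ₁ ≤ 1 / Real.sqrt 3 →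
    ∀ (N : ℝ → ℝ) (σ₀ : ℝ), 0 ≤ σ₀ → 0 < N σ₀ →
      (∀ Δ : ℝ, 0 < Δ → Δ < Δ₁ → N σ₀ - N (σ₀ + Δ) ≤ (1 + t₀)⁻¹ * Δ * N σ₀) →
      ∀ Δ : ℝ, 0 < Δ → Δ < Δ₁ → N (σ₀ + Δ) ≤ N σ₀ - cmuLow t₀ * Δ ^ α * N σ₀

/-- **Step 3, scalar core** — what (359) reduces to for the time-independent first iterate after
`∫G_p dy = 1` and `∫_{σ_{p−1}}^{σ_p} μ ≤ Δ·μ(0) = Δ/(1+t₀)`: `c_{μ,t₀} Δ^α ≤ Δ/(1+t₀)` for every sub-step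
length `Δ ∈ (0, 1/√3]` and every `α ∈ (0,1)`. Not consumed by any composition (FAILURE-MODES F15).
[cite: Kampen2014AutoControlledNS, (359) p. 72] -/
def Step_3Scalar : Prop :=
  ∀ t₀ : ℝ, 0 ≤ t₀ → ∀ α : ℝ, 0 < α → α < 1 → ∀ Δ : ℝ, 0 < Δ → Δ ≤ 1 / Real.sqrt 3 →
    cmuLow t₀ * Δ ^ α ≤ (1 + t₀)⁻¹ * Δ

/-- **Step 4 — Lemma 6.15 p. 70, (350) [lem3] with Remark 6.16 (the discrete bound preservation).**
«Assume that some t₀ ≥ 0 is given … ‖v^{t₀}(t₀,·)‖_{H^m∩C^m} ≤ C + Ct₀ (348) … such that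
‖u^{ρ̃,t₀}(0,·)‖_{H^m∩C^m} ≤ C (349) … Then there is a triple of small positive real numbers Δ, c, ρ with
0 < ρ ≤ ρ̃ such [that] … for all 1 ≤ p ≤ N: ‖u^{ρ,t₀}(σ_{p−1},·)‖ ≤ C ⇒ ‖u^{ρ,t₀}(σ_p,·)‖ ≤ C (350)»; Remark
6.16: «the triple Δ, c, ρ … can be chosen independently of the time step number p ≤ N as C > 0 is
preserved»; grid `σ_p = pΔ ∈ [0, 1/√3]` (p. 72, `c_e = 1/2`). TYPED for the comparison function `uComp`
of a regular solution on `[t₀, t₀ + ρ]`, the pair `(Δ, ρ)` chosen from `(ν, m, C, T)` before `t₀ ∈ [0,T]`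
(the constant `c` of the triple plays no role in (350)). Printed proof pp. 71–75: the representation
(356), Step 3, the product/kernel bounds (362)–(365), (366)–(367) and the closing display (369)
`ρ ≤ [c_{μ,t₀}Δ^{α+δ−1}C/2 − ε]/[c^μ_{t₀}nC_GC_m(1+nC_K)C²]`. Typist's flag: suspicious (rests on Step 3).
[cite: Kampen2014AutoControlledNS, Lemma 6.15 (348)–(350) p. 70, Remark 6.16 p. 70, (369) p. 75] -/
def Step_4 : Prop :=
  ∀ ν : ℝ, 0 < ν → ∀ m : ℕ, 2 ≤ m → ∀ C : ℝ, 0 < C → ∀ T : ℝ, 0 < T →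
    ∃ Δ : ℝ, 0 < Δ ∧ ∃ ρ : ℝ, 0 < ρ ∧ ρ ≤ 1 ∧
      ∀ t₀ ∈ Icc 0 T, ∀ (v : ℝ → EuclideanSpace ℝ (Fin 3) → EuclideanSpace ℝ (Fin 3))
        (p : ℝ → EuclideanSpace ℝ (Fin 3) → ℝ),
        IsLocalSolution ν t₀ (t₀ + ρ) v p → hcNorm m (v t₀) ≤ (1 + t₀) * C →
          ∀ k : ℕ, ((k : ℝ) + 1) * Δ ≤ 1 / Real.sqrt 3 →
            hcNorm m (uComp ρ t₀ v ((k : ℝ) * Δ)) ≤ C →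
              hcNorm m (uComp ρ t₀ v (((k : ℝ) + 1) * Δ)) ≤ C

/-- **Step 5 — Lemma 6.4 p. 62, (295) [lem2], the LOAD-BEARING a priori statement.** «Assume that t₀ ≥ 0
and ρ̃ > 0 are such that Lemma 6.1 holds for v^{ρ̃,t₀}_i … and such that (293)
[‖v^{ρ,t₀}(t₀,·)‖_{H^m∩C^m} ≤ (1+t₀)C] holds with ρ̃. Then there is some 0 < ρ ≤ ρ̃ (which does not depend
essentially on the time horizon T > 0) such that ‖u^{ρ,t₀}(0,·)‖_{H^m∩C^m} ≤ C ⇒ ‖u^{ρ,t₀}(σ,·)‖_{H^m∩C^m} ≤ C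
for all σ ≥ 0 (295)»; Remark 6.6 p. 62: «ρ does not depend essentially on T means ρ ≳ 1/T^s for some
s ∈ (0,1)»; p. 64: «(315) holds for a ρ > 0 which depends only on C, n, ν and T». TYPED with that
quantifier order (`ρ` from `(ν, m, C, T)`, then every `t₀ ∈ [0,T]` and every regular solution on
`[t₀, t₀+ρ]` with (293)); since `u^{ρ,t₀}(0) = v(t₀)/(1+t₀)`, (294) is (293). Printed proof: Remark 6.5
(«sufficient and easier to prove Lemma 6.4 for discrete times σ») + Lemma 6.15 = Step 4. Typist's flag:
suspicious as a METHOD (the chain needs it with one `C` across restarts), plausible as a statement for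
`ρ` small w.r.t. the Lipschitz-in-time constant of the norm (the allowance `(1+τ)C` grows at rate `C/ρ`).
[cite: Kampen2014AutoControlledNS, Lemma 6.4 (293)–(295) pp. 61–62, Remark 6.6 p. 62, (315) p. 64] -/
def Step_5 : Prop :=
  ∀ ν : ℝ, 0 < ν → ∀ m : ℕ, 2 ≤ m → ∀ C : ℝ, 0 < C → ∀ T : ℝ, 0 < T →
    ∃ ρ : ℝ, 0 < ρ ∧ ρ ≤ 1 ∧
      ∀ t₀ ∈ Icc 0 T, ∀ (v : ℝ → EuclideanSpace ℝ (Fin 3) → EuclideanSpace ℝ (Fin 3))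
        (p : ℝ → EuclideanSpace ℝ (Fin 3) → ℝ),
        IsLocalSolution ν t₀ (t₀ + ρ) v p → hcNorm m (v t₀) ≤ (1 + t₀) * C →
          ∀ σ : ℝ, 0 ≤ σ → hcNorm m (uComp ρ t₀ v σ) ≤ C

/-- **Step 6 — the transfer back to `v` with the SAME constant, pp. 62–63, (299)–(308).** From (300)
«‖u^{ρ,t_max}(σ,·)‖_{H^m∩C^m} ≤ C for all σ ∈ [0, c^σ_e]» the main line concludes «All these variations imply
that there exists some C > 0 such that ‖v^{t_max}(t,·)‖_{H^m∩C^m} ≤ (1+t)C (308) for all t_max ≤ t ≤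
t_max + ρc_e. Then (296) together with (308) lead to a contradiction to the maximality of t_max in (296)»
— the contradiction requires (308) with the constant `C` of (296), which is the reading typed here (with
`c_e = 1/2`). Since `(1+τ)u^{ρ,t₀}(σ) = v(t)`, `τ = t₀ + (t−t₀)/ρ ≥ t`, the abstract inference is
`Step_6Abs`; the author's weaker transfer (316) with `C′ = C/ρ` (Remark 6.7 p. 64: «Hence there is no
simple transition to (308) with the same C > 0») is `Step_6Weak`. Typist's flag: suspicious.
[cite: Kampen2014AutoControlledNS, (299)–(308) pp. 62–63] -/
def Step_6 : Prop :=
  ∀ ν : ℝ, 0 < ν → ∀ m : ℕ, 2 ≤ m → ∀ C : ℝ, 0 < C → ∀ ρ : ℝ, 0 < ρ → ρ ≤ 1 → ∀ t₀ : ℝ, 0 ≤ t₀ →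
    ∀ (v : ℝ → EuclideanSpace ℝ (Fin 3) → EuclideanSpace ℝ (Fin 3))
      (p : ℝ → EuclideanSpace ℝ (Fin 3) → ℝ),
      IsLocalSolution ν t₀ (t₀ + ρ) v p → hcNorm m (v t₀) ≤ (1 + t₀) * C →
        (∀ σ : ℝ, 0 ≤ σ → hcNorm m (uComp ρ t₀ v σ) ≤ C) →
          ∀ t ∈ Icc t₀ (t₀ + ρ / 2), hcNorm m (v t) ≤ (1 + t) * C

/-- **Step 6, abstract grain (TYPING-HYGIENE 13)** — the real-number inference behind (308) with the same
constant: from `‖v(t)‖ = (1 + τ)‖u(σ)‖` ((283), `τ = t₀ + (t − t₀)/ρ`, (313) p. 64) and `‖u(σ)‖ ≤ C` conclude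
`‖v(t)‖ ≤ (1 + t)C`, for `0 < ρ < 1`, `t₀ ≤ t ≤ t₀ + ρ/2`. Not consumed by any composition.
[cite: Kampen2014AutoControlledNS, (308) p. 63, (313)–(314) p. 64] -/
def Step_6Abs : Prop :=
  ∀ ρ t₀ t U C : ℝ, 0 < ρ → ρ < 1 → 0 ≤ t₀ → t₀ ≤ t → t ≤ t₀ + ρ / 2 → 0 ≤ U → U ≤ C →
    (1 + (t₀ + (t - t₀) / ρ)) * U ≤ (1 + t) * C

/-- **Step 6, the author's weak variant — Remark 6.7, (313)–(316) pp. 64–65**: with `C′ = C/ρ`,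
«C′(1+t) ≥ (1+t)(1/ρ)‖u^{ρ,t_max}(σ,·)‖ ≥ ‖v^{ρ,t_max}(t_max + (t−t_max)/ρ,·)‖ = ‖v^{t_max}(t,·)‖ (316)», i.e.
at the abstract grain `(1 + t₀ + (t−t₀)/ρ)·U ≤ (1+t)·(C/ρ)` for `U ≤ C`, `0 < ρ ≤ 1`, `t ≥ t₀ ≥ 0` (true
arithmetic). With it the constant is NOT preserved across a restart, so the next application of Lemma
6.4 (Step 5) is with `C/ρ` in place of `C` — the induction «ρ … independent of t_max. Hence we get (309)»
(p. 65) is not carried out in print (module docstring, COMPOSITION).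
[cite: Kampen2014AutoControlledNS, Remark 6.7 (313)–(316) pp. 64–65] -/
def Step_6Weak : Prop :=
  ∀ ρ t₀ t U C : ℝ, 0 < ρ → ρ ≤ 1 → 0 ≤ t₀ → t₀ ≤ t → 0 ≤ U → U ≤ C →
    (1 + (t₀ + (t - t₀) / ρ)) * U ≤ (1 + t) * (C / ρ)

/-- **Step 7 — the conclusion of the contradiction argument in the WEAK reading (278)/(309),
pp. 62–65**: «Now for contradiction assume that there is a maximal t_max such that a solution v_i with
v_i ∈ C¹((0,t_max], H^m∩C^m) ∩ C⁰([0,t_max], H^m∩C^m) … with a linear upper bound as in (277) exists (296)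
… Then (296) together with (308) lead to a contradiction to the maximality of t_max» (pp. 62–63); Remark
6.7: «Hence we get (309)» = «∀T > 0 ∃C > 0 ∀0 ≤ t ≤ T: ‖v_i(t,·)‖_{H^m} ≤ C + Ct» (p. 64–65). TYPED as
the statement reached: for every `T` a regular solution on `[0,T]` from `h` with the linear `H^m` bound.
Printed support: Steps 1, 5, 6 (restart at `t_max` by Lemma 6.1, Lemma 6.4, transfer). Typist's flag:
suspicious (load-bearing; as a statement it is regularity on every finite horizon).
[cite: Kampen2014AutoControlledNS, (296)–(308) pp. 62–63, Remark 6.7 (309) pp. 64–65] -/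
def Step_7 : Prop :=
  ∀ ν : ℝ, 0 < ν → ∀ m : ℕ, 2 ≤ m → ∀ h : EuclideanSpace ℝ (Fin 3) → EuclideanSpace ℝ (Fin 3),
    IsDatum h → ∀ T : ℝ, 0 < T → ∃ C : ℝ, 0 < C ∧
      ∃ (u : ℝ → EuclideanSpace ℝ (Fin 3) → EuclideanSpace ℝ (Fin 3))
        (p : ℝ → EuclideanSpace ℝ (Fin 3) → ℝ),
        IsLocalSolution ν 0 T u p ∧ u 0 = h ∧ ∀ t ∈ Icc 0 T, hmNorm m (u t) ≤ C + C * t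

/-- **Step 7s — the same conclusion in the STRONG reading (279) = (277)** (Remark 5.2 p. 59: «∃C > 0
∀T > 0 ∀0 ≤ t ≤ T: ‖v_i(t,·)‖_{H^m} ≤ C + Ct (279) … Both claims can be proved»; p. 65: «Hence the statement
in (277) of the main theorem holds with the constant C′. Here we use that ρ > 0 can be chosen such that
it depends on the time horizon T > 0 but is independent of t_max»). One constant for all horizons.
Typist's flag: suspicious (the `C′ = C/ρ(T)` of (316) depends on `T`).
[cite: Kampen2014AutoControlledNS, Remark 5.2 (279) p. 59, Remark 6.7 p. 65] -/
def Step_7s : Prop :=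
  ∀ ν : ℝ, 0 < ν → ∀ m : ℕ, 2 ≤ m → ∀ h : EuclideanSpace ℝ (Fin 3) → EuclideanSpace ℝ (Fin 3),
    IsDatum h → ∃ C : ℝ, 0 < C ∧ ∀ T : ℝ, 0 < T →
      ∃ (u : ℝ → EuclideanSpace ℝ (Fin 3) → EuclideanSpace ℝ (Fin 3))
        (p : ℝ → EuclideanSpace ℝ (Fin 3) → ℝ),
        IsLocalSolution ν 0 T u p ∧ u 0 = h ∧ ∀ t ∈ Icc 0 T, hmNorm m (u t) ≤ C + C * t

/-- **Step 8 — IMPLICIT globalisation, (276) p. 58 with Remark 1.4 p. 7 (uniqueness «via [Gronwall's]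
inequality» in the class) and §6 p. 59 («uniqueness is not claimed by this method»).** From regular
solutions on every `[0,T]` to ONE global regular solution on `[0,∞)`, which moreover inherits every linear
`H^m` bound that holds with one constant on all finite horizons (uniqueness in the class identifies the
pieces; gluing). Unprinted; true as typed (Majda–Bertozzi Cor. 3.1, tree
`IsClassicalNSSolutionOn.eq_of_hasBoundedSobolevNormsOn`, and choice). Typist's flag: classical, implicit.
[cite: Kampen2014AutoControlledNS, Thm 5.1 (276) p. 58, Remark 1.4 p. 7] -/
def Step_8 : Prop :=
  ∀ ν : ℝ, 0 < ν → ∀ h : EuclideanSpace ℝ (Fin 3) → EuclideanSpace ℝ (Fin 3), IsDatum h →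
    (∀ T : ℝ, 0 < T → ∃ (u : ℝ → EuclideanSpace ℝ (Fin 3) → EuclideanSpace ℝ (Fin 3))
        (p : ℝ → EuclideanSpace ℝ (Fin 3) → ℝ), IsLocalSolution ν 0 T u p ∧ u 0 = h) →
    ∃ (u : ℝ → EuclideanSpace ℝ (Fin 3) → EuclideanSpace ℝ (Fin 3))
      (p : ℝ → EuclideanSpace ℝ (Fin 3) → ℝ),
      IsGlobalSolution ν h u p ∧
        ∀ (m : ℕ) (C : ℝ),
          (∀ T : ℝ, 0 < T → ∃ (w : ℝ → EuclideanSpace ℝ (Fin 3) → EuclideanSpace ℝ (Fin 3))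
              (q : ℝ → EuclideanSpace ℝ (Fin 3) → ℝ),
              IsLocalSolution ν 0 T w q ∧ w 0 = h ∧ ∀ t ∈ Icc 0 T, hmNorm m (w t) ≤ C + C * t) →
          ∀ t : ℝ, 0 ≤ t → hmNorm m (u t) ≤ C + C * t

/-! ### Kernel relations -/

/-- The strong reading implies the weak one ((279) ⇒ (278), Remark 5.2 p. 59).
[cite: Kampen2014AutoControlledNS, Remark 5.2 p. 59] -/
theorem step_7_of_step_7s (h : Step_7s) : Step_7 := by
  intro ν hν m hm h0 hh T hT
  obtain ⟨C, hC, hall⟩ := h ν hν m hm h0 hh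
  obtain ⟨u, p, hu⟩ := hall T hT
  exact ⟨C, hC, u, p, hu⟩

/-- **KERNEL COMPOSITION.** Thm 5.1 (276)–(277) follows from the Steps; the proof consumes `Step_7s`
(the strong conclusion of the contradiction argument) and `Step_8` (globalisation): for each `m ≥ 2` the
bound with one constant on all `[0,T]` transfers to the global solution. Steps 1–6 are the printed support
of Step 7/7s (module docstring, COMPOSITION). [cite: Kampen2014AutoControlledNS, Thm 5.1 pp. 58–59] -/
theorem claim_of_steps : Step_1 → Step_2 → Step_3 → Step_4 → Step_5 → Step_6 → Step_7 → Step_7s →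
    Step_8 → ClaimedTheorem := by
  intro _ _ _ _ _ _ _ h7s h8 ν hν h hh
  -- solutions on every finite horizon (from the strong conclusion at `m = 2`)
  have hloc : ∀ T : ℝ, 0 < T → ∃ (u : ℝ → EuclideanSpace ℝ (Fin 3) → EuclideanSpace ℝ (Fin 3))
      (p : ℝ → EuclideanSpace ℝ (Fin 3) → ℝ), IsLocalSolution ν 0 T u p ∧ u 0 = h := by
    intro T hT
    obtain ⟨C, -, hall⟩ := h7s ν hν 2 le_rfl h hh
    obtain ⟨u, p, hu, hu0, -⟩ := hall T hT
    exact ⟨u, p, hu, hu0⟩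
  obtain ⟨u, p, hG, htransfer⟩ := h8 ν hν h hh hloc
  refine ⟨u, p, hG, fun m hm => ?_⟩
  obtain ⟨C, -, hall⟩ := h7s ν hν m hm h hh
  exact ⟨C, htransfer m C hall⟩

/-- **Clay link: the claimed theorem implies Clay (A)** (`ClayVariants.clayR3.Regularity`, token for token
the summit body): a Clay datum (smooth, divergence free, rapid decay (4)) is a datum of the class
(Schwartz ⇒ `H^∞`, tree `HasRapidSpatialDecay.lintegral_enorm_iteratedFDeriv_sq_lt_top`); the global
regular solution is smooth on `ℝ³ × [0,∞)` with `u(0) = u₀` (bridge `isNavierStokesSolution_and_smooth_iff`),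
and the energy bound (7) holds with `C = ∫|u₀|²` by the tree's energy inequality in the BKM class
(`IsClassicalNSSolutionOn.bkm_energy_le`, Majda–Bertozzi Prop. 3.1) — Δ5 of the module docstring
discharged, no delta of substance (same argument as the cell's `Chae2007.clay_of_claimedNS`).
[cite: FeffermanClay2006, statement (A), CMI offprint p. 2] -/
theorem clay_of_claimed (hC : ClaimedTheorem) : ClayVariants.clayR3.Regularity := by
  intro ν hν u₀ hu₀ hdiv hdecay
  have hdat : IsDatum u₀ :=
    ⟨hu₀, fun x => hdiv x, fun n => hdecay.lintegral_enorm_iteratedFDeriv_sq_lt_top n⟩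
  obtain ⟨u, p, hsol, -⟩ := hC ν hν u₀ hdat
  obtain ⟨hns, hsu, hsp⟩ :=
    (isNavierStokesSolution_and_smooth_iff (ν := ν) (f := 0) (u₀ := u₀) (u := u) (p := p)).2
      ⟨hsol.isClassical, hsol.initial⟩
  refine ⟨u, p, hsu, hsp, hns, ?_⟩
  show HasBoundedEnergy u
  -- finite energy of the slices and the identity `∫⁻ ‖u t‖ₑ² = ofReal (∫ ‖u t‖²)` in the class
  have key : ∀ S : ℝ, 0 < S → ∀ τ ∈ Icc (0:ℝ) S,
      ∫⁻ x, ‖u τ x‖ₑ ^ 2 = ENNReal.ofReal (∫ x, ‖u τ x‖ ^ 2) := by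
    intro S hS τ hτ
    have hcl : IsClassicalNSSolutionOn (Icc 0 S) ν 0 u p :=
      hsol.isClassical.mono Icc_subset_Ici_self (uniqueDiffOn_Icc hS)
    obtain ⟨C, hC⟩ := hsol.sobolev S 0
    have hfin0 : ∫⁻ x, ‖iteratedFDeriv ℝ 0 (u τ) x‖ₑ ^ 2 < ⊤ := (hC τ hτ).trans_lt ENNReal.coe_lt_top
    have heq : (fun x => ‖iteratedFDeriv ℝ 0 (u τ) x‖ₑ ^ 2) = fun x => ‖u τ x‖ₑ ^ 2 := by
      funext x
      rw [← ofReal_norm, norm_iteratedFDeriv_zero, ofReal_norm]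
    have hfin : ∫⁻ x, ‖u τ x‖ₑ ^ 2 < ⊤ := by rwa [heq] at hfin0
    have hint : Integrable (fun x => ‖u τ x‖ ^ 2) :=
      integrable_sq_norm_of_lintegral_lt_top (hcl.contDiff_velocity hτ).continuous hfin
    rw [ofReal_integral_eq_lintegral_ofReal hint (Eventually.of_forall fun x => sq_nonneg _)]
    refine lintegral_congr fun x => ?_
    rw [← ofReal_norm, ENNReal.ofReal_pow (norm_nonneg _)]
  refine ⟨∫⁻ x, ‖u₀ x‖ₑ ^ 2, ?_, fun t ht => ?_⟩
  · have h0 := hdat.2.2 0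
    have heq : (fun x => ‖iteratedFDeriv ℝ 0 u₀ x‖ₑ ^ 2) = fun x => ‖u₀ x‖ₑ ^ 2 := by
      funext x
      rw [← ofReal_norm, norm_iteratedFDeriv_zero, ofReal_norm]
    rwa [heq] at h0
  · have hT : (0:ℝ) < t + 1 := by linarith
    have hcl : IsClassicalNSSolutionOn (Icc 0 (t + 1)) ν 0 u p :=
      hsol.isClassical.mono Icc_subset_Ici_self (uniqueDiffOn_Icc hT)
    have hE : ∫ x, ‖u t x‖ ^ 2 ≤ ∫ x, ‖u 0 x‖ ^ 2 :=
      hcl.bkm_energy_le hν.le hT (hsol.sobolev (t + 1)) ⟨ht, by linarith⟩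
    rw [key (t + 1) hT t ⟨ht, by linarith⟩, ← hsol.initial, key (t + 1) hT 0 ⟨le_rfl, hT.le⟩]
    exact ENNReal.ofReal_le_ofReal hE

/-! ### Rev 2 (additive): the closing display of Lemma 6.15's proof; Lemma 6.4 with Remark 6.6 -/

/-- **Step 3½ — the closing display of the proof of Lemma 6.15, (366)–(369) pp. 74–75 [l.3727–3756], at
the abstract grain (TYPING-HYGIENE 13).** Printed: «Using the induction hypothesis (with respect to the
iteration index p) we have ‖u^{ρ,t₀,p,q}_i(pΔ,·)‖_{H^m∩C^m} ≤ C + ε − c_{μ,t₀}(σ_p − σ_{p−1})^α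
‖u^{ρ,t₀,p,q−1}_i(σ_{p−1},·)‖_{H^m∩C^m} + ρ c^μ_{t₀} n C_G Δ^{1−δ} C_m (1 + nC_K) C² (366). Now we may assume
without loss of generality that ‖u^{ρ,t₀,p,q−1}_i(σ_{p−1},·)‖_{H^m∩C^m} ≥ C/2 (367) … Under the assumption
(367) we get ‖u^{ρ,t₀,p,q}_i(pΔ,·)‖_{H^m∩C^m} ≤ C if ρ ≤ [c_{μ,t₀}Δ^{α+δ−1}·C/2 − ε]/[c^μ_{t₀} n C_G C_m
(1 + nC_K) C²] (369). As ε > 0 is arbitrary this concludes the proof in the discrete case … where we are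
free to choose an appropriate scaling for ε > 0» (`δ ∈ (0.5, 1)` from the kernel bound (362) p. 73,
`α ∈ (0,1)` from (359), grid `Δ ≤ 1/√3`). This is WHERE (359) = `Step_3` IS CONSUMED: the admissible `ρ`
in (369) is positive only through the gain coefficient `c_{μ,t₀}Δ^α` that Step 3 supplies as the drop
`c_{μ,t₀}Δ^α ‖u(σ_{p−1})‖` in (366). TYPED over reals — `Uprev = ‖u^{p,q−1}(σ_{p−1})‖`, `Unew =
‖u^{p,q}(pΔ)‖`, `K = n C_G C_m (1 + nC_K) > 0` (the unspecified «standard estimate» constants, (363)–(365)),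
`c_{μ,t₀} = cmuLow t₀` and `c^μ_{t₀} = cmuUp t₀` concrete — in the `ε`-free form that «ε > 0 is
arbitrary» produces. It is elementary and PROVED (`step_4Close_holds`); `step_4Close_residual` records what
the literal display with `ε` on both sides gives. So the arithmetic of the closing display is sound GIVEN
(366), i.e. given Step 3 and the increment bounds (363)–(365); the latter are not typed at the PDE grain
(the Picard iterates `u^{ρ,t₀,p,q}` and the fundamental solution `G_p` of the damped equation (356) are not
in the tree). Under the charitable reading of Step 3 (gain of the true order `α = 1`) the same display
admits `ρ ≤ (c_{μ,t₀}/c^μ_{t₀}) Δ^δ/(2KC)`, still positive but `∼ (1 + t₀)^{−2}` — see `Step_5Unif`. Typist's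
flag: plausible (true as typed). [cite: Kampen2014AutoControlledNS, (366)–(369) pp. 74–75] -/
def Step_4Close : Prop :=
  ∀ t₀ C K Δ α δ ρ Uprev Unew : ℝ, 0 ≤ t₀ → 0 < C → 0 < K → 0 < Δ → Δ ≤ 1 / Real.sqrt 3 →
    0 < α → α < 1 → 1 / 2 < δ → δ < 1 → 0 < ρ →
    Unew ≤ C - cmuLow t₀ * Δ ^ α * Uprev + ρ * cmuUp t₀ * K * Δ ^ (1 - δ) * C ^ 2 →
    C / 2 ≤ Uprev →
    ρ ≤ cmuLow t₀ * Δ ^ (α + δ - 1) * (C / 2) / (cmuUp t₀ * K * C ^ 2) →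
    Unew ≤ C

/-- `c_{μ,t₀} ≥ 0` and `c^μ_{t₀} > 0` for `t₀ ≥ 0` ((357)–(358) p. 72).
[cite: Kampen2014AutoControlledNS, (357)–(358) p. 72] -/
theorem cmuLow_nonneg {t₀ : ℝ} (ht₀ : 0 ≤ t₀) : 0 ≤ cmuLow t₀ := by
  unfold cmuLow
  exact div_nonneg (by positivity) (by linarith)

/-- [cite: Kampen2014AutoControlledNS, (358) p. 72] -/
theorem cmuUp_pos {t₀ : ℝ} (ht₀ : 0 ≤ t₀) : 0 < cmuUp t₀ := by
  unfold cmuUp; linarith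

/-- The closing display is sound as arithmetic: (366) ∧ (367) ∧ (369) ⟹ `‖u^{p,q}(pΔ)‖ ≤ C` (ε-free form).
PROVED. [cite: Kampen2014AutoControlledNS, (366)–(369) pp. 74–75] -/
theorem step_4Close_holds : Step_4Close := by
  intro t₀ C K Δ α δ ρ Uprev Unew ht₀ hC hK hΔ _hΔ' _hα _hα' _hδ _hδ' _hρ h366 h367 h369
  have hup : 0 < cmuUp t₀ := cmuUp_pos ht₀
  have hlow : 0 ≤ cmuLow t₀ := cmuLow_nonneg ht₀
  have hden : 0 < cmuUp t₀ * K * C ^ 2 := by positivity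
  have hΔpow : (0:ℝ) < Δ ^ (1 - δ) := Real.rpow_pos_of_pos hΔ _
  have hΔα : (0:ℝ) ≤ Δ ^ α := (Real.rpow_pos_of_pos hΔ _).le
  have h1 : ρ * (cmuUp t₀ * K * C ^ 2) ≤ cmuLow t₀ * Δ ^ (α + δ - 1) * (C / 2) :=
    (le_div_iff₀ hden).mp h369
  have hsplit : Δ ^ (α + δ - 1) * Δ ^ (1 - δ) = Δ ^ α := by
    rw [← Real.rpow_add hΔ]; ring_nf
  have h2 : ρ * cmuUp t₀ * K * Δ ^ (1 - δ) * C ^ 2 ≤ cmuLow t₀ * Δ ^ α * (C / 2) := by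
    have h := mul_le_mul_of_nonneg_right h1 hΔpow.le
    calc ρ * cmuUp t₀ * K * Δ ^ (1 - δ) * C ^ 2
        = ρ * (cmuUp t₀ * K * C ^ 2) * Δ ^ (1 - δ) := by ring
      _ ≤ cmuLow t₀ * Δ ^ (α + δ - 1) * (C / 2) * Δ ^ (1 - δ) := h
      _ = cmuLow t₀ * (Δ ^ (α + δ - 1) * Δ ^ (1 - δ)) * (C / 2) := by ring
      _ = cmuLow t₀ * Δ ^ α * (C / 2) := by rw [hsplit]
  have h3 : cmuLow t₀ * Δ ^ α * (C / 2) ≤ cmuLow t₀ * Δ ^ α * Uprev :=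
    mul_le_mul_of_nonneg_left h367 (mul_nonneg hlow hΔα)
  linarith

/-- The literal display with `ε` kept on both sides ((366) carries `+ ε`, (369) carries `− ε` in the
numerator) yields `‖u^{p,q}(pΔ)‖ ≤ C + ε(1 − Δ^{1−δ})`, not `≤ C`: the residue the print absorbs by «we are
free to choose an appropriate scaling for ε > 0» (p. 75) — replacing the numerator's `ε` by `εΔ^{δ−1}`
makes it exact. Recorded so that no verdict turns on this bookkeeping. PROVED.
[cite: Kampen2014AutoControlledNS, (366)–(369) pp. 74–75] -/
theorem step_4Close_residual (t₀ C ε K Δ α δ ρ Uprev Unew : ℝ) (ht₀ : 0 ≤ t₀) (hC : 0 < C)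
    (hK : 0 < K) (hΔ : 0 < Δ)
    (h366 : Unew ≤ C + ε - cmuLow t₀ * Δ ^ α * Uprev + ρ * cmuUp t₀ * K * Δ ^ (1 - δ) * C ^ 2)
    (h367 : C / 2 ≤ Uprev)
    (h369 : ρ ≤ (cmuLow t₀ * Δ ^ (α + δ - 1) * (C / 2) - ε) / (cmuUp t₀ * K * C ^ 2)) :
    Unew ≤ C + ε * (1 - Δ ^ (1 - δ)) := by
  have hup : 0 < cmuUp t₀ := cmuUp_pos ht₀
  have hlow : 0 ≤ cmuLow t₀ := cmuLow_nonneg ht₀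
  have hden : 0 < cmuUp t₀ * K * C ^ 2 := by positivity
  have hΔpow : (0:ℝ) < Δ ^ (1 - δ) := Real.rpow_pos_of_pos hΔ _
  have hΔα : (0:ℝ) ≤ Δ ^ α := (Real.rpow_pos_of_pos hΔ _).le
  have h1 : ρ * (cmuUp t₀ * K * C ^ 2) ≤ cmuLow t₀ * Δ ^ (α + δ - 1) * (C / 2) - ε :=
    (le_div_iff₀ hden).mp h369
  have hsplit : Δ ^ (α + δ - 1) * Δ ^ (1 - δ) = Δ ^ α := by
    rw [← Real.rpow_add hΔ]; ring_nf
  have h2 : ρ * cmuUp t₀ * K * Δ ^ (1 - δ) * C ^ 2 ≤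
      cmuLow t₀ * Δ ^ α * (C / 2) - ε * Δ ^ (1 - δ) := by
    have h := mul_le_mul_of_nonneg_right h1 hΔpow.le
    calc ρ * cmuUp t₀ * K * Δ ^ (1 - δ) * C ^ 2
        = ρ * (cmuUp t₀ * K * C ^ 2) * Δ ^ (1 - δ) := by ring
      _ ≤ (cmuLow t₀ * Δ ^ (α + δ - 1) * (C / 2) - ε) * Δ ^ (1 - δ) := h
      _ = cmuLow t₀ * (Δ ^ (α + δ - 1) * Δ ^ (1 - δ)) * (C / 2) - ε * Δ ^ (1 - δ) := by ring
      _ = cmuLow t₀ * Δ ^ α * (C / 2) - ε * Δ ^ (1 - δ) := by rw [hsplit]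
  have h3 : cmuLow t₀ * Δ ^ α * (C / 2) ≤ cmuLow t₀ * Δ ^ α * Uprev :=
    mul_le_mul_of_nonneg_left h367 (mul_nonneg hlow hΔα)
  linarith

/-- **Step 5′ — Lemma 6.4 (295) p. 62 WITH Remark 6.6's uniformity clause (ref-3 F-check (iii)).** Lemma 6.4:
«there is some 0 < ρ ≤ ρ̃ (which does not depend essentially on the time horizon T > 0) such that
‖u^{ρ,t₀}(0,·)‖_{H^m∩C^m} ≤ C ⇒ ‖u^{ρ,t₀}(σ,·)‖_{H^m∩C^m} ≤ C for all σ ≥ 0 (295)»; Remark 6.6 p. 62: «The phrase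
'ρ does not depend essentially on the time horizon T' means ρ ≳ 1/T^s fo[r] some s ∈ (0,1)»; Remark 6.5
p. 62: «it is sufficient to prove Lemma 6.4 for a finite interval of times σ ∈ [0,T] for some T ≥ 1 for
example»; p. 6 / p. 57: the clause is what lets «global existence results transfer from τ-coordinates …
to original time t». TYPED as `Step_5` with the lower bound `ρ ≥ c₀ T^{−s}` for `T ≥ 1`, the pair
`(s, c₀)` depending on `(ν, m, C)` only (the implied constant of «≳»; p. 64: ρ «depends only on C, n, ν
and T»); it implies `Step_5` (`step_5_of_step_5Unif`, PROVED). Under the charitable reading of Step 3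
(gain of order `α = 1`) the closing display (369) admits only `ρ ≲ (c_{μ,t₀}/c^μ_{t₀}) Δ^δ/(KC) ∼
(1 + t₀)^{−2} Δ^δ/(KC)`, `t₀ ≤ T` (ns-claims-ref-3 RETYPE §3) — the tension with this clause that the
referee names; nothing here asserts either side. Typist's flag: suspicious (load-bearing).
[cite: Kampen2014AutoControlledNS, Lemma 6.4 (295) p. 62, Remarks 6.5–6.6 p. 62] -/
def Step_5Unif : Prop :=
  ∀ ν : ℝ, 0 < ν → ∀ m : ℕ, 2 ≤ m → ∀ C : ℝ, 0 < C →
    ∃ s : ℝ, 0 < s ∧ s < 1 ∧ ∃ c₀ : ℝ, 0 < c₀ ∧ ∀ T : ℝ, 1 ≤ T →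
      ∃ ρ : ℝ, c₀ * T ^ (-s) ≤ ρ ∧ ρ ≤ 1 ∧
        ∀ t₀ ∈ Icc 0 T, ∀ (v : ℝ → EuclideanSpace ℝ (Fin 3) → EuclideanSpace ℝ (Fin 3))
          (p : ℝ → EuclideanSpace ℝ (Fin 3) → ℝ),
          IsLocalSolution ν t₀ (t₀ + ρ) v p → hcNorm m (v t₀) ≤ (1 + t₀) * C →
            ∀ σ : ℝ, 0 ≤ σ → hcNorm m (uComp ρ t₀ v σ) ≤ C

/-- Remark 6.6's form implies the plain form of Lemma 6.4 (`Step_5`): for `T < 1` use the `ρ` of the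
horizon `max T 1`. PROVED. [cite: Kampen2014AutoControlledNS, Lemma 6.4 (295) p. 62, Remark 6.6 p. 62] -/
theorem step_5_of_step_5Unif (h : Step_5Unif) : Step_5 := by
  intro ν hν m hm C hC T _hT
  obtain ⟨s, _hs, _hs1, c₀, hc₀, hT'⟩ := h ν hν m hm C hC
  have hT1 : (1:ℝ) ≤ max T 1 := le_max_right _ _
  obtain ⟨ρ, hρlow, hρ1, hρ⟩ := hT' (max T 1) hT1
  have hρpos : 0 < ρ :=
    lt_of_lt_of_le (mul_pos hc₀ (Real.rpow_pos_of_pos (lt_of_lt_of_le one_pos hT1) _)) hρlow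
  refine ⟨ρ, hρpos, hρ1, ?_⟩
  intro t₀ ht₀ v p hv hb σ hσ
  exact hρ t₀ ⟨ht₀.1, ht₀.2.trans (le_max_left _ _)⟩ v p hv hb σ hσ

/-! ### Step 2 holds — the coefficient bounds (357)–(358) p. 72 (D-0026 in-file discharge; the
verdict of record #22, locator `Step_3`, is untouched) -/

/-- `1 + τ(σ) > 0` for `t₀ ≥ 0` (since `|σ| < √(1+σ²)`). Re-proved from the Summits-side
`…Theorems.Kampen2014.one_add_tau_pos` (SoloRefuteKampen2014.lean), not importable here.
[folklore] -/
private theorem one_add_tauOf_pos (t₀ σ : ℝ) (ht₀ : 0 ≤ t₀) : 0 < 1 + tauOf t₀ σ := by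
  unfold tauOf
  have hs : 0 < Real.sqrt (1 + σ ^ 2) := Real.sqrt_pos.2 (by positivity)
  have habs : |σ| < Real.sqrt (1 + σ ^ 2) := by
    rw [Real.lt_sqrt (abs_nonneg σ), sq_abs]; linarith
  have hlow : -Real.sqrt (1 + σ ^ 2) < σ := by
    have := (abs_lt.1 habs).1; linarith
  have : -1 < σ / Real.sqrt (1 + σ ^ 2) := by
    rw [lt_div_iff₀ hs]; linarith
  linarith

/-- On `σ ∈ [0, 1/√3]`, `τ(σ) ≤ t₀ + 1/2` (`σ/√(1+σ²) ≤ 1/2 ⇔ 3σ² ≤ 1`). [folklore] -/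
private theorem tauOf_le (t₀ σ : ℝ) (hσ0 : 0 ≤ σ) (hσ1 : σ ≤ 1 / Real.sqrt 3) :
    tauOf t₀ σ ≤ t₀ + 1 / 2 := by
  unfold tauOf
  have hs3sq : Real.sqrt 3 ^ 2 = 3 := Real.sq_sqrt (by norm_num)
  have hσsq : σ ^ 2 ≤ 1 / 3 := by
    have := pow_le_pow_left₀ hσ0 hσ1 2
    rwa [div_pow, one_pow, hs3sq] at this
  have hsqrt_pos : 0 < Real.sqrt (1 + σ ^ 2) := Real.sqrt_pos.2 (by positivity)
  have h2 : 2 * σ ≤ Real.sqrt (1 + σ ^ 2) := by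
    rw [Real.le_sqrt (by positivity) (by positivity)]
    nlinarith
  have : σ / Real.sqrt (1 + σ ^ 2) ≤ 1 / 2 := by
    rw [div_le_iff₀ hsqrt_pos]; linarith
  linarith

/-- **Step 2 holds — (357)–(358) p. 72**: on `σ ∈ [0, 1/√3]`, `c_{μ,t₀} = 3√3/(12+8t₀) ≤ μ(σ)` and
`μ(σ)(1+τ(σ))² ≤ 3/2 + t₀ = c^μ_{t₀}`. Proof: `σ² ≤ 1/3` gives `(1+σ²)^{3/2} ≤ 8/(3√3)` and
`(1+σ²)^{3/2} ≥ 1`, while `0 < 1 + τ(σ) ≤ 3/2 + t₀`. The (357) half is the Summits-side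
`…Theorems.Kampen2014.mu_lower` (SoloRefuteKampen2014.lean, re-proved here because Literature
cannot import Summits); the (358) half is new. Typist's «calculus» flag discharged in the declaring
file; the verdict of record (#22, locator `Step_3`) is unaffected.
[cite: Kampen2014AutoControlledNS, (357)–(358) p. 72] -/
theorem step_2_holds : Step_2 := by
  intro t₀ ht₀ σ hσ0 hσ1
  have hs3sq : Real.sqrt 3 ^ 2 = 3 := Real.sq_sqrt (by norm_num)
  have hσsq : σ ^ 2 ≤ 1 / 3 := by
    have := pow_le_pow_left₀ hσ0 hσ1 2
    rwa [div_pow, one_pow, hs3sq] at this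
  have hτ : tauOf t₀ σ ≤ t₀ + 1 / 2 := tauOf_le t₀ σ hσ0 hσ1
  have hτpos : 0 < 1 + tauOf t₀ σ := one_add_tauOf_pos t₀ σ ht₀
  -- `A = (1+σ²)^{3/2}` with `1 ≤ A ≤ 8/(3√3)`
  set A := (1 + σ ^ 2) ^ ((3 : ℝ) / 2) with hA
  have hApos : 0 < A := Real.rpow_pos_of_pos (by positivity) _
  have hAsq : A ^ 2 = (1 + σ ^ 2) ^ 3 := by
    rw [hA, ← Real.rpow_natCast, ← Real.rpow_mul (by positivity)]
    norm_num
  have hB : 0 < 8 / (3 * Real.sqrt 3) := by positivity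
  have hAle : A ≤ 8 / (3 * Real.sqrt 3) := by
    rw [← pow_le_pow_iff_left₀ hApos.le hB.le two_ne_zero, hAsq, div_pow, mul_pow, hs3sq]
    rw [le_div_iff₀ (by norm_num)]
    nlinarith [hσsq, sq_nonneg σ, sq_nonneg (σ ^ 2)]
  have hAge : 1 ≤ A := by
    rw [← pow_le_pow_iff_left₀ zero_le_one hApos.le two_ne_zero, hAsq, one_pow]
    nlinarith [sq_nonneg σ, sq_nonneg (σ ^ 2)]
  -- `μ(σ) = A⁻¹ / (1 + τ)`
  have hmu : muOf t₀ σ = A⁻¹ / (1 + tauOf t₀ σ) := by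
    rw [muOf, show (-(3 : ℝ) / 2) = -((3 : ℝ) / 2) by ring, Real.rpow_neg (by positivity)]
  refine ⟨?_, ?_⟩
  · -- (357): `cmuLow t₀ * (1 + τ) ≤ cmuLow t₀ * (3/2 + t₀) = 3√3/8 ≤ A⁻¹`
    rw [hmu, le_div_iff₀ hτpos]
    have hc : cmuLow t₀ * (3 / 2 + t₀) = 3 * Real.sqrt 3 / 8 := by
      unfold cmuLow
      field_simp
      ring
    have hcpos : 0 < cmuLow t₀ := by unfold cmuLow; positivity
    have h1 : cmuLow t₀ * (1 + tauOf t₀ σ) ≤ 3 * Real.sqrt 3 / 8 := by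
      rw [← hc]
      exact mul_le_mul_of_nonneg_left (by linarith) hcpos.le
    have h2 : 3 * Real.sqrt 3 / 8 ≤ A⁻¹ := by
      rw [le_inv_comm₀ (by positivity) hApos, inv_div]
      exact hAle
    linarith
  · -- (358): `μ(σ)(1+τ)² = A⁻¹ (1 + τ) ≤ 1 · (3/2 + t₀)`
    have hAinv : A⁻¹ ≤ 1 := inv_le_one_of_one_le₀ hAge
    have hAinv0 : 0 ≤ A⁻¹ := inv_nonneg.2 hApos.le
    have e : muOf t₀ σ * (1 + tauOf t₀ σ) ^ 2 = A⁻¹ * (1 + tauOf t₀ σ) := by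
      rw [hmu]
      field_simp
    rw [e, cmuUp]
    calc A⁻¹ * (1 + tauOf t₀ σ) ≤ 1 * (1 + tauOf t₀ σ) :=
          mul_le_mul_of_nonneg_right hAinv hτpos.le
      _ ≤ 3 / 2 + t₀ := by linarith

/-! ### `Step_1` and `Step_8` discharged (APPEND-ONLY, cell `ns-claims` typist-12 g5, 2026-08-27)

Both are the «classical» binders of `claim_of_steps` (the typist's flags): Lemma 6.1 p. 59 (uniform local
existence) and the implicit globalisation behind (276) p. 58. Inputs, all theorems of the tree: the `H¹` local
theory with lifespan `‖u₀‖⁴_{H¹} T ≤ c ν³` (`tao2011_smooth_local_existence_holds`, Tao 2013 Thm 5.4), time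
translation of classical solutions (`IsClassicalNSSolutionOn.comp_add_right`), the generic horizon patching
`IsClassicalNSSolutionOn.exists_Ici_of_forall_Icc_of_unique` and Majda–Bertozzi uniqueness in the BKM class
(`MajdaBertozzi2002_uniquenessSobolev_holds`, Cor. 3.1). -/

/-- The `C^m` part of the intersection norm is nonnegative (suprema of norms; the junk value of an unbounded
supremum is `0`). [cite: Kampen2014AutoControlledNS, §1 p. 2] -/
theorem cmNorm_nonneg (m : ℕ) (w : EuclideanSpace ℝ (Fin 3) → EuclideanSpace ℝ (Fin 3)) : 0 ≤ cmNorm m w :=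
  Finset.sum_nonneg fun _ _ => Real.iSup_nonneg fun _ => norm_nonneg _

/-- `‖w‖_{H^m} ≤ ‖w‖_{H^m ∩ C^m}`. [cite: Kampen2014AutoControlledNS, (293)–(295) pp. 61–62] -/
theorem hmNorm_le_hcNorm (m : ℕ) (w : EuclideanSpace ℝ (Fin 3) → EuclideanSpace ℝ (Fin 3)) :
    hmNorm m w ≤ hcNorm m w :=
  le_add_of_nonneg_right (cmNorm_nonneg m w)

/-- The `H¹` budget of a datum of the class from its `H^m` norm, `m ≥ 1`, in the shape consumed by
`tao2011_smooth_local_existence`: `∫‖w‖² + ∫|∇w|²_F ≤ 3 ‖w‖²_{H^m}`.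
[cite: Kampen2014AutoControlledNS, (277) p. 59] -/
theorem h1Budget_le_of_hmNorm_le {m : ℕ} (hm : 1 ≤ m)
    {w : EuclideanSpace ℝ (Fin 3) → EuclideanSpace ℝ (Fin 3)} (hw : IsDatum w) {B : ℝ}
    (hwB : hmNorm m w ≤ B) :
    (∫⁻ x, ‖w x‖ₑ ^ 2) + (∫⁻ x, ENNReal.ofReal (frobeniusNormSq (fderiv ℝ w x))) ≤
      ENNReal.ofReal (3 * B ^ 2) := by
  obtain ⟨-, -, hfin⟩ := hw
  have hne : hmNormSq m w ≠ ⊤ := ENNReal.sum_ne_top.2 fun n _ => (hfin n).ne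
  -- `‖w‖²_{H^m} ≤ B²`
  have hsq : (hmNormSq m w).toReal ≤ B ^ 2 := by
    have h : Real.sqrt (hmNormSq m w).toReal ^ 2 ≤ B ^ 2 := pow_le_pow_left₀ (Real.sqrt_nonneg _) hwB 2
    rwa [Real.sq_sqrt ENNReal.toReal_nonneg] at h
  have hle : hmNormSq m w ≤ ENNReal.ofReal (B ^ 2) :=
    (ENNReal.le_ofReal_iff_toReal_le hne (by positivity)).2 hsq
  -- the two lowest terms of `‖w‖²_{H^m}`
  have h01 : (∫⁻ x, ‖iteratedFDeriv ℝ 0 w x‖ₑ ^ 2) + (∫⁻ x, ‖iteratedFDeriv ℝ 1 w x‖ₑ ^ 2) ≤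
      hmNormSq m w := by
    have hsub : Finset.range 2 ⊆ Finset.range (m + 1) := Finset.range_mono (by omega : 2 ≤ m + 1)
    have h2 : ∑ n ∈ Finset.range 2, ∫⁻ x, ‖iteratedFDeriv ℝ n w x‖ₑ ^ 2 =
        (∫⁻ x, ‖iteratedFDeriv ℝ 0 w x‖ₑ ^ 2) + ∫⁻ x, ‖iteratedFDeriv ℝ 1 w x‖ₑ ^ 2 := by
      simp [Finset.sum_range_succ]
    rw [← h2]
    exact Finset.sum_le_sum_of_subset hsub
  have h0 : (∫⁻ x, ‖w x‖ₑ ^ 2) = ∫⁻ x, ‖iteratedFDeriv ℝ 0 w x‖ₑ ^ 2 := by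
    refine lintegral_congr fun x => ?_
    rw [← ofReal_norm, ← ofReal_norm (iteratedFDeriv ℝ 0 w x), norm_iteratedFDeriv_zero]
  calc (∫⁻ x, ‖w x‖ₑ ^ 2) + (∫⁻ x, ENNReal.ofReal (frobeniusNormSq (fderiv ℝ w x)))
      ≤ (∫⁻ x, ‖iteratedFDeriv ℝ 0 w x‖ₑ ^ 2) + 3 * ∫⁻ x, ‖iteratedFDeriv ℝ 1 w x‖ₑ ^ 2 := by
        rw [h0]
        exact add_le_add le_rfl (lintegral_frobeniusNormSq_le_three_mul_iteratedFDeriv_one w)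
    _ ≤ 3 * ((∫⁻ x, ‖iteratedFDeriv ℝ 0 w x‖ₑ ^ 2) + ∫⁻ x, ‖iteratedFDeriv ℝ 1 w x‖ₑ ^ 2) := by
        rw [mul_add]
        exact add_le_add (le_mul_of_one_le_left bot_le (by norm_num)) le_rfl
    _ ≤ 3 * ENNReal.ofReal (B ^ 2) := by gcongr; exact h01.trans hle
    _ = ENNReal.ofReal (3 * B ^ 2) := by
        rw [ENNReal.ofReal_mul (by norm_num : (0:ℝ) ≤ 3), ENNReal.ofReal_ofNat]

/-- **`Step_1` HOLDS** (Lemma 6.1 (280) p. 59, rendered): for `ν > 0`, `m ≥ 2` and a bound `B`, the lifespan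
`ρ̃ := c ν³ / (3B²)²` of Tao's `H¹` local theory serves every datum of the class with `‖w‖_{H^m∩C^m} ≤ B`, at
any starting time `t₀ ≥ 0` (translate the solution launched at time `0`). The solution is classical on
`[t₀, t₀ + ρ̃] × ℝ³` with all Sobolev norms bounded there (`IsLocalSolution`).
[cite: Kampen2014AutoControlledNS, Lemma 6.1 (280) p. 59] [cite: Tao2011, Thm. 5.4 (ii)+(iv)] -/
theorem step_1_holds : Step_1 := by
  intro ν hν m hm B hB
  obtain ⟨c, hc, hloc⟩ := tao2011_smooth_local_existence_holds
  have hA : (0 : ℝ) < 3 * B ^ 2 := by positivity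
  refine ⟨c * ν ^ 3 / (3 * B ^ 2) ^ 2, by positivity, ?_⟩
  intro t₀ _ w hw hwB
  have hT : 0 < c * ν ^ 3 / (3 * B ^ 2) ^ 2 := by positivity
  have hsize := h1Budget_le_of_hmNorm_le (by omega : 1 ≤ m) hw ((hmNorm_le_hcNorm m w).trans hwB)
  have hsmall : (3 * B ^ 2) ^ 2 * (c * ν ^ 3 / (3 * B ^ 2) ^ 2) ≤ c * ν ^ 3 := by
    rw [mul_div_cancel₀ _ (pow_ne_zero 2 hA.ne')]
  obtain ⟨v, q, hcl, hv0, hsob, -⟩ := hloc hν hT hw.1 hw.2.1 hw.2.2 hA.le hsize hsmall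
  set ρ : ℝ := c * ν ^ 3 / (3 * B ^ 2) ^ 2 with hρ
  -- translate the solution from `[0, ρ]` to `[t₀, t₀ + ρ]`
  have hset : (fun t : ℝ => t + -t₀) ⁻¹' Icc 0 ρ = Icc t₀ (t₀ + ρ) := by
    ext t
    simp only [mem_preimage, mem_Icc]
    constructor <;> rintro ⟨h₁, h₂⟩ <;> constructor <;> linarith
  refine ⟨fun t => v (t + -t₀), fun t => q (t + -t₀), ⟨?_, ?_⟩, by simp [hv0]⟩
  · have h := hcl.comp_add_right (-t₀)
    rw [hset] at h
    exact h
  · intro n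
    obtain ⟨C, hC⟩ := hsob n
    exact ⟨C, fun t ht => hC (t + -t₀) ⟨by linarith [ht.1], by linarith [ht.2]⟩⟩

/-- **`Step_8` HOLDS** (the implicit globalisation behind (276) p. 58): local solutions of the class on every
`[0, T]` from the same datum agree at common times (Majda–Bertozzi Cor. 3.1, the tree's
`MajdaBertozzi2002_uniquenessSobolev_holds`), so they patch to ONE classical solution on `[0, ∞)`
(`IsClassicalNSSolutionOn.exists_Ici_of_forall_Icc_of_unique`; pressure normalised by `p(t,0) = 0`), which is
in the class on every `[0, T]` and inherits, by the same uniqueness, every slice-wise bound — in particular the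
linear `H^m` bounds `‖v(t)‖_{H^m} ≤ C + C t` holding with one constant on all finite horizons.
[cite: Kampen2014AutoControlledNS, Thm 5.1 (276) p. 58, Remark 1.4 p. 7] [cite: MajdaBertozzi2002, Cor. 3.1 (p. 88)] -/
theorem step_8_holds : Step_8 := by
  intro ν hν h _ hex
  -- uniqueness across horizons in the class
  have huniq : ∀ (T₁ T₂ : ℝ) (U₁ : ℝ → EuclideanSpace ℝ (Fin 3) → EuclideanSpace ℝ (Fin 3))
      (P₁ : ℝ → EuclideanSpace ℝ (Fin 3) → ℝ) (U₂ : ℝ → EuclideanSpace ℝ (Fin 3) → EuclideanSpace ℝ (Fin 3))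
      (P₂ : ℝ → EuclideanSpace ℝ (Fin 3) → ℝ),
      (IsLocalSolution ν 0 T₁ U₁ P₁ ∧ U₁ 0 = h) → (IsLocalSolution ν 0 T₂ U₂ P₂ ∧ U₂ 0 = h) →
        ∀ t ∈ Icc 0 T₁, t ≤ T₂ → U₁ t = U₂ t := by
    rintro T₁ T₂ U₁ P₁ U₂ P₂ ⟨⟨hc₁, hs₁⟩, h₁⟩ ⟨⟨hc₂, hs₂⟩, h₂⟩ t ht htT
    rcases eq_or_lt_of_le ht.1 with h0 | htpos
    · rw [← h0, h₁, h₂]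
    · have hU : UniqueDiffOn ℝ (Icc (0 : ℝ) t) := uniqueDiffOn_Icc htpos
      exact MajdaBertozzi2002_uniquenessSobolev_holds hν.le htpos
        (hc₁.mono (Icc_subset_Icc_right ht.2) hU) (hc₂.mono (Icc_subset_Icc_right htT) hU)
        (hs₁.mono (Icc_subset_Icc_right ht.2)) (hs₂.mono (Icc_subset_Icc_right htT))
        (h₁.trans h₂.symm) t ⟨ht.1, le_rfl⟩
  obtain ⟨u, p, hcl, hu0, -, hpiece⟩ :=
    IsClassicalNSSolutionOn.exists_Ici_of_forall_Icc_of_unique (ν := ν) (f := 0) (u₀ := h)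
      (fun T U P => IsLocalSolution ν 0 T U P ∧ U 0 = h) (fun T U P hQ => ⟨hQ.1.1, hQ.2⟩) hex huniq
  -- the patched solution is in the class on every `[0, T]`
  have hsob : ∀ T : ℝ, HasBoundedSobolevNormsOn (Icc 0 T) u := by
    intro T
    obtain ⟨T', U, P, hTT', hQ, hUeq, -⟩ := hpiece (max T 1) (lt_max_of_lt_right one_pos)
    have hb : HasBoundedSobolevNormsOn (Icc 0 (max T 1)) U := hQ.1.2.mono (Icc_subset_Icc_right hTT')
    intro n
    obtain ⟨C, hC⟩ := hb n
    refine ⟨C, fun t ht => ?_⟩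
    have ht' : t ∈ Icc 0 (max T 1) := Icc_subset_Icc_right (le_max_left _ _) ht
    rw [hUeq t ht']
    exact hC t ht'
  refine ⟨u, p, ⟨hcl, hu0, hsob⟩, ?_⟩
  intro m C hfam t ht
  obtain ⟨w, q, ⟨hwc, hws⟩, hw0, hwb⟩ := hfam (t + 1) (by linarith)
  have hT1 : (0 : ℝ) < t + 1 := by linarith
  have hut : u t = w t :=
    MajdaBertozzi2002_uniquenessSobolev_holds hν.le hT1
      (hcl.mono Icc_subset_Ici_self (uniqueDiffOn_Icc hT1)) hwc (hsob (t + 1)) hws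
      (hu0.trans hw0.symm) t ⟨ht, by linarith⟩
  rw [hut]
  exact hwb t ⟨ht, by linarith⟩

/-- `Step_6Weak` holds as typed — it is the «true arithmetic» the module docstring calls it (Remark 6.7
(313)–(316): with `C′ = C/ρ`): for `0 < ρ ≤ 1`, `0 ≤ t₀ ≤ t`, `0 ≤ U ≤ C`,
`(1 + t₀ + (t − t₀)/ρ)·U ≤ (1 + t)·(C/ρ)`, because after multiplying by `ρ` it reads
`(ρ(1 + t₀) + (t − t₀))·U ≤ (1 + t)·C` and `ρ(1 + t₀) ≤ 1 + t₀`. Elementary; appended 2026-08-29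
(D-0026 bookkeeping: a Step of the claim skeleton that is a true inequality, discharged; this endorses
nothing else in the paper — `Step_6Abs`, the same-constant transfer the print needs, is a different
statement). [cite: Kampen2014AutoControlledNS, Remark 6.7 (313)–(316) pp. 64–65] -/
theorem Step_6Weak_holds : Step_6Weak := by
  intro ρ t₀ t U C hρ hρ1 ht₀ ht hU hUC
  have hC : 0 ≤ C := hU.trans hUC
  have hfac : 0 ≤ 1 + (t₀ + (t - t₀) / ρ) := by
    have : 0 ≤ (t - t₀) / ρ := div_nonneg (by linarith) hρ.le
    linarith
  calc (1 + (t₀ + (t - t₀) / ρ)) * U ≤ (1 + (t₀ + (t - t₀) / ρ)) * C :=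
        mul_le_mul_of_nonneg_left hUC hfac
    _ ≤ (1 + t) * (C / ρ) := by
        rw [← sub_nonneg]
        have key : (1 + t) * (C / ρ) - (1 + (t₀ + (t - t₀) / ρ)) * C =
            C * ((1 - ρ) * (1 + t₀)) / ρ := by
          field_simp
          ring
        rw [key]
        exact div_nonneg (mul_nonneg hC (mul_nonneg (by linarith) (by linarith))) hρ.le

end Literature.Claims.NS.Kampen2014

end

-- WHAT THIS IS NOT: not a claim about NS regularity or blow-up; not a claim about any author beyond the
-- typed locator.
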